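import Summits.Parity.GeneralizedHardyLittlewood.Theorems.BeyondDiagonalBeatsQuarter.KernelFormXSqCollapse
import Summits.Parity.GeneralizedHardyLittlewood.Theorems.BeyondDiagonalBeatsQuarter.KernelFormXSqSumsB
import HarnessLib

/-!
# The three error sums of the `X²` kernel form: `R₁ = ΣφW²δS`, `X = ΣφW²κS²`, `R₂ = ΣφW²δP`

Supports stmt-Parity-20343 (`PrimeLevelFamEdge.BeyondDiagonalBeatsQuarter`, K_B; line
`diagonal_kernel_split`, registered stub `stub_kernelFormXSq`). A helper; it closes nothing. Namespace
`Summit.Parity.GeneralizedHardyLittlewood.Theorems.BeyondDiagonalBeatsQuarter.KernelFormXSq`.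

With `S_n = S(M/n;n) = 2E_n + δ_n`, `|δ_n| ≤ C_δD(n)/(1+log(M/n))²`, `|S_n| ≤ C_S D(n)`
(`KernelFormXSqCore`), `φ(n)W(n)² ≤ 1/n`, and the summation lemmas of `KernelFormXSqSums*`:

* `abs_primeSum_le` — `|P_n| ≤ 2C_S D(n)(log(M/n) + log 4)` (`D(np) ≤ 2D(n)`, Chebyshev);
* `abs_errSum_one_le` — `|Σ_{n≤M} φW²δ_nS_n| ≤ 8C_δC_S Z₂` (dyadic lemma);
* `abs_errSum_kappa_le` — `|Σ φW²κ(n)S_n²| ≤ 48C_S²Z₂(2 + log M)`;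
* `abs_errSum_two_le` — `|Σ φW²δ_nP_n| ≤ 4C_δC_S Z₂(2 + log M)`,
`Z₂ = (Σ_d d^{−5/4})²`. Everything here is PROVED (theorems only).
«The programme SEARCHES and TYPES; no claim about Landau–Siegel zeros, Theorems 1–2 of
arXiv:2211.02515 or a repaired Margin232 until a kernel theorem says so.»
-/

noncomputable section

open scoped Real ArithmeticFunction.Moebius ArithmeticFunction.sigma ArithmeticFunction.zeta
open Finset ArithmeticFunction

namespace Summit.Parity.GeneralizedHardyLittlewood.Theorems.BeyondDiagonalBeatsQuarter.KernelFormXSq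

open Literature.NumberTheory.LFunctions Literature.NumberTheory.LFunctions.KMV2000
open MollifierMainTerm (W)
open SelbergCoord (kappa)

/-! ### Pointwise inputs on `n ∈ [1, ⌊M⌋]` -/

/-- `|P_n| ≤ 2C_S·D(n)·(log(M/n) + log 4)` for `1 ≤ n ≤ M`, given the crude bound
`|S(y;m)| ≤ C_S D(m)` (`y ≥ 1`): `|S_{np}| ≤ C_S D(np) ≤ 2C_S D(n)` and Chebyshev.
[cite: KowalskiMichelVanderKam2000, (23) — derivation] -/
theorem abs_primeSum_le {C_S : ℝ} (hS : ∀ n : ℕ, n ≠ 0 → ∀ y : ℝ, 1 ≤ y → |coprimeSum n y| ≤ C_S * divWeight n)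
    {M : ℝ} (hM : 1 ≤ M) {n : ℕ} (hn : n ∈ Icc 1 ⌊M⌋₊) :
    |primeSum M n| ≤ 2 * C_S * divWeight n * (Real.log (M / n) + Real.log 4) := by
  have hn' := Finset.mem_Icc.1 hn
  have hn0 : n ≠ 0 := by omega
  have hn0' : (0 : ℝ) < n := by exact_mod_cast hn'.1
  have hM0 : 0 < M := by linarith
  have hNM : (⌊M⌋₊ : ℝ) ≤ M := Nat.floor_le hM0.le
  have hCS : 0 ≤ C_S := by
    have h := hS 1 one_ne_zero 1 le_rfl
    have hD : divWeight 1 = 1 := by simp [divWeight]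
    rw [hD, mul_one] at h
    exact (abs_nonneg _).trans h
  have hD0 := divWeight_nonneg n
  have hB0 : 0 ≤ 2 * C_S * divWeight n := by positivity
  -- termwise
  have hterm : ∀ j ∈ Icc 1 (⌊M⌋₊ / n),
      |(if j.Prime ∧ ¬ j ∣ n then Real.log j / ((j : ℝ) + 1) * coprimeSum (n * j) (M / ((n * j : ℕ) : ℝ)) else 0)| ≤
        (if j.Prime ∧ ¬ j ∣ n then Real.log j / ((j : ℝ) + 1) * (2 * C_S * divWeight n) else 0) := by
    intro j hj
    have hj' := Finset.mem_Icc.1 hj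
    split_ifs with hc
    · have hj0 : (0 : ℝ) < j := by exact_mod_cast hj'.1
      have hlog : 0 ≤ Real.log j := Real.log_nonneg (by exact_mod_cast hj'.1)
      have hnj : n * j ≤ ⌊M⌋₊ := by
        have := (Nat.le_div_iff_mul_le hn'.1).1 hj'.2
        rwa [mul_comm] at this
      have hnj0 : (0 : ℝ) < ((n * j : ℕ) : ℝ) := by
        have : 0 < n * j := Nat.mul_pos hn'.1 hj'.1
        exact_mod_cast this
      have hy : 1 ≤ M / ((n * j : ℕ) : ℝ) := by
        rw [le_div_iff₀ hnj0, one_mul]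
        exact le_trans (by exact_mod_cast hnj) hNM
      have h1 := hS (n * j) (Nat.mul_pos hn'.1 hj'.1).ne' _ hy
      have h2 : divWeight (n * j) ≤ 2 * divWeight n := by
        rw [mul_comm]; exact divWeight_prime_mul_le hc.1 hn0
      rw [abs_mul, abs_of_nonneg (div_nonneg hlog (by positivity))]
      refine mul_le_mul_of_nonneg_left (h1.trans ?_) (div_nonneg hlog (by positivity))
      nlinarith
    · simp
  have hlogle : Real.log ((⌊M⌋₊ / n : ℕ) : ℝ) ≤ Real.log (M / n) := by
    have hq1 : 1 ≤ ⌊M⌋₊ / n := (Nat.le_div_iff_mul_le hn'.1).2 (by simpa using hn'.2)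
    refine Real.log_le_log (by exact_mod_cast hq1) ?_
    calc ((⌊M⌋₊ / n : ℕ) : ℝ) ≤ (⌊M⌋₊ : ℝ) / n := Nat.cast_div_le
      _ ≤ M / n := div_le_div_of_nonneg_right hNM hn0'.le
  calc |primeSum M n| ≤ ∑ j ∈ Icc 1 (⌊M⌋₊ / n),
        |(if j.Prime ∧ ¬ j ∣ n then Real.log j / ((j : ℝ) + 1) * coprimeSum (n * j) (M / ((n * j : ℕ) : ℝ))
          else 0)| := Finset.abs_sum_le_sum_abs _ _
    _ ≤ ∑ j ∈ Icc 1 (⌊M⌋₊ / n),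
        (if j.Prime ∧ ¬ j ∣ n then Real.log j / ((j : ℝ) + 1) * (2 * C_S * divWeight n) else 0) :=
        Finset.sum_le_sum hterm
    _ ≤ (2 * C_S * divWeight n) * (Real.log ((⌊M⌋₊ / n : ℕ) : ℝ) + Real.log 4) :=
        sum_prime_log_div_succ_le n _ hB0
    _ ≤ 2 * C_S * divWeight n * (Real.log (M / n) + Real.log 4) :=
        mul_le_mul_of_nonneg_left (by linarith) hB0

/-! ### The three error sums -/

/-- `0 ≤ φ(n)W(n)²`. [folklore] -/
theorem totient_mul_W_sq_nonneg (n : ℕ) : 0 ≤ (Nat.totient n : ℝ) * W n ^ 2 := by positivity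

/-- **`R₁`**: `|Σ_{n ≤ M} φW²·(S_n − 2E_n)·S_n| ≤ 8C_δC_S Z₂` (dyadic lemma). [cite: KowalskiMichelVanderKam2000, Prop. 5.1 — derivation (error bookkeeping)] -/
theorem abs_errSum_one_le {C_δ C_S : ℝ}
    (hδ : ∀ n : ℕ, n ≠ 0 → ∀ y : ℝ, 1 ≤ y →
      |coprimeSum n y - 2 * mainConst n| ≤ C_δ * divWeight n / (1 + Real.log y) ^ 2)
    (hS : ∀ n : ℕ, n ≠ 0 → ∀ y : ℝ, 1 ≤ y → |coprimeSum n y| ≤ C_S * divWeight n)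
    {M : ℝ} (hM : 1 ≤ M) :
    |∑ n ∈ Icc 1 ⌊M⌋₊, (Nat.totient n : ℝ) * W n ^ 2 *
        ((coprimeSum n (M / n) - 2 * mainConst n) * coprimeSum n (M / n))| ≤
      C_δ * C_S * (8 * (∑' d : ℕ, (d : ℝ) ^ (-(5 / 4 : ℝ))) ^ 2) := by
  have hM0 : 0 < M := by linarith
  have hNM : (⌊M⌋₊ : ℝ) ≤ M := Nat.floor_le hM0.le
  have hCδ : 0 ≤ C_δ := by
    have h := hδ 1 one_ne_zero 1 le_rfl
    have hD : divWeight 1 = 1 := by simp [divWeight]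
    rw [hD, Real.log_one] at h; norm_num at h
    exact (abs_nonneg _).trans h
  have hterm : ∀ n ∈ Icc 1 ⌊M⌋₊, |(Nat.totient n : ℝ) * W n ^ 2 *
      ((coprimeSum n (M / n) - 2 * mainConst n) * coprimeSum n (M / n))| ≤
      C_δ * C_S * (divWeight n ^ 2 / (n * (1 + Real.log (M / n)) ^ 2)) := by
    intro n hn
    have hn' := Finset.mem_Icc.1 hn
    have hn0 : n ≠ 0 := by omega
    have hn0' : (0 : ℝ) < n := by exact_mod_cast hn'.1
    have hy : 1 ≤ M / n := by
      rw [le_div_iff₀ hn0', one_mul]; exact le_trans (by exact_mod_cast hn'.2) hNM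
    have hlog : 0 ≤ Real.log (M / n) := Real.log_nonneg hy
    have h1 := hδ n hn0 _ hy
    have h2 := hS n hn0 _ hy
    have hc := totient_mul_W_sq_le n
    have hc0 := totient_mul_W_sq_nonneg n
    have hD0 := divWeight_nonneg n
    rw [abs_mul, abs_of_nonneg hc0, abs_mul]
    calc (Nat.totient n : ℝ) * W n ^ 2 * (|coprimeSum n (M / n) - 2 * mainConst n| * |coprimeSum n (M / n)|)
        ≤ (n : ℝ)⁻¹ * (C_δ * divWeight n / (1 + Real.log (M / n)) ^ 2 * (C_S * divWeight n)) :=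
          mul_le_mul hc (mul_le_mul h1 h2 (abs_nonneg _) (by positivity)) (by positivity) (by positivity)
      _ = C_δ * C_S * (divWeight n ^ 2 / (n * (1 + Real.log (M / n)) ^ 2)) := by
          field_simp
  refine (Finset.abs_sum_le_sum_abs _ _).trans ((Finset.sum_le_sum hterm).trans ?_)
  rw [← Finset.mul_sum]
  have hCS : 0 ≤ C_S := by
    have h := hS 1 one_ne_zero 1 le_rfl
    have hD : divWeight 1 = 1 := by simp [divWeight]
    rw [hD, mul_one] at h
    exact (abs_nonneg _).trans h
  exact mul_le_mul_of_nonneg_left (sum_divWeight_sq_dyadic_le hM) (by positivity)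

/-- **`X`**: `|Σ_{n ≤ M} φW²κ(n)S_n²| ≤ 48 C_S² Z₂(2 + log M)` (`M ≥ 1`).
[cite: KowalskiMichelVanderKam2000, Prop. 5.1 — derivation (error bookkeeping)] -/
theorem abs_errSum_kappa_le {C_S : ℝ}
    (hS : ∀ n : ℕ, n ≠ 0 → ∀ y : ℝ, 1 ≤ y → |coprimeSum n y| ≤ C_S * divWeight n)
    {M : ℝ} (hM : 1 ≤ M) :
    |∑ n ∈ Icc 1 ⌊M⌋₊, (Nat.totient n : ℝ) * W n ^ 2 * (kappa n * coprimeSum n (M / n) ^ 2)| ≤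
      C_S ^ 2 * (48 * (∑' d : ℕ, (d : ℝ) ^ (-(5 / 4 : ℝ))) ^ 2 * (2 + Real.log M)) := by
  have hM0 : 0 < M := by linarith
  have hNM : (⌊M⌋₊ : ℝ) ≤ M := Nat.floor_le hM0.le
  have hN1 : 1 ≤ ⌊M⌋₊ := Nat.le_floor (by simpa using hM)
  have hterm : ∀ n ∈ Icc 1 ⌊M⌋₊, |(Nat.totient n : ℝ) * W n ^ 2 * (kappa n * coprimeSum n (M / n) ^ 2)| ≤
      C_S ^ 2 * (kappa n * divWeight n ^ 2 / n) := by
    intro n hn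
    have hn' := Finset.mem_Icc.1 hn
    have hn0 : n ≠ 0 := by omega
    have hn0' : (0 : ℝ) < n := by exact_mod_cast hn'.1
    have hy : 1 ≤ M / n := by
      rw [le_div_iff₀ hn0', one_mul]; exact le_trans (by exact_mod_cast hn'.2) hNM
    have h2 := hS n hn0 _ hy
    have hc := totient_mul_W_sq_le n
    have hc0 := totient_mul_W_sq_nonneg n
    have hk0 : 0 ≤ kappa n := by
      unfold kappa
      refine Finset.sum_nonneg fun p hp ↦ ?_
      have h2 : (2 : ℝ) ≤ p := by exact_mod_cast (Nat.prime_of_mem_primeFactors hp).two_le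
      exact div_nonneg (Real.log_nonneg (by linarith)) (by linarith)
    have hsq : coprimeSum n (M / n) ^ 2 ≤ (C_S * divWeight n) ^ 2 := by
      rw [← sq_abs]; exact pow_le_pow_left₀ (abs_nonneg _) h2 2
    rw [abs_of_nonneg (by positivity)]
    calc (Nat.totient n : ℝ) * W n ^ 2 * (kappa n * coprimeSum n (M / n) ^ 2)
        ≤ (n : ℝ)⁻¹ * (kappa n * (C_S * divWeight n) ^ 2) :=
          mul_le_mul hc (mul_le_mul_of_nonneg_left hsq hk0) (by positivity) (by positivity)
      _ = C_S ^ 2 * (kappa n * divWeight n ^ 2 / n) := by ring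
  refine (Finset.abs_sum_le_sum_abs _ _).trans ((Finset.sum_le_sum hterm).trans ?_)
  rw [← Finset.mul_sum]
  refine mul_le_mul_of_nonneg_left ((sum_kappa_divWeight_sq_div_le hN1).trans ?_) (sq_nonneg _)
  have hlog : Real.log (⌊M⌋₊ : ℝ) ≤ Real.log M := Real.log_le_log (by exact_mod_cast hN1) hNM
  have hZ : 0 ≤ 48 * (∑' d : ℕ, (d : ℝ) ^ (-(5 / 4 : ℝ))) ^ 2 := by positivity
  nlinarith

/-- **`R₂`**: `|Σ_{n ≤ M} φW²·(S_n − 2E_n)·P_n| ≤ 4C_δC_S Z₂(2 + log M)` (`M ≥ 1`;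
`(log(M/n) + log 4)/(1 + log(M/n))² ≤ 2`). [cite: KowalskiMichelVanderKam2000, Prop. 5.1 — derivation (error bookkeeping)] -/
theorem abs_errSum_two_le {C_δ C_S : ℝ}
    (hδ : ∀ n : ℕ, n ≠ 0 → ∀ y : ℝ, 1 ≤ y →
      |coprimeSum n y - 2 * mainConst n| ≤ C_δ * divWeight n / (1 + Real.log y) ^ 2)
    (hS : ∀ n : ℕ, n ≠ 0 → ∀ y : ℝ, 1 ≤ y → |coprimeSum n y| ≤ C_S * divWeight n)
    {M : ℝ} (hM : 1 ≤ M) :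
    |∑ n ∈ Icc 1 ⌊M⌋₊, (Nat.totient n : ℝ) * W n ^ 2 *
        ((coprimeSum n (M / n) - 2 * mainConst n) * primeSum M n)| ≤
      4 * C_δ * C_S * ((∑' d : ℕ, (d : ℝ) ^ (-(5 / 4 : ℝ))) ^ 2 * (2 + Real.log M)) := by
  have hM0 : 0 < M := by linarith
  have hNM : (⌊M⌋₊ : ℝ) ≤ M := Nat.floor_le hM0.le
  have hN1 : 1 ≤ ⌊M⌋₊ := Nat.le_floor (by simpa using hM)
  have hCδ : 0 ≤ C_δ := by
    have h := hδ 1 one_ne_zero 1 le_rfl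
    have hD : divWeight 1 = 1 := by simp [divWeight]
    rw [hD, Real.log_one] at h; norm_num at h
    exact (abs_nonneg _).trans h
  have hCS : 0 ≤ C_S := by
    have h := hS 1 one_ne_zero 1 le_rfl
    have hD : divWeight 1 = 1 := by simp [divWeight]
    rw [hD, mul_one] at h
    exact (abs_nonneg _).trans h
  have hl4 : Real.log 4 ≤ 2 := by
    have : Real.log 4 = 2 * Real.log 2 := by
      rw [show (4 : ℝ) = 2 ^ 2 by norm_num, Real.log_pow]; ring
    have h2 := Real.log_two_lt_d9
    linarith
  have hterm : ∀ n ∈ Icc 1 ⌊M⌋₊, |(Nat.totient n : ℝ) * W n ^ 2 *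
      ((coprimeSum n (M / n) - 2 * mainConst n) * primeSum M n)| ≤
      4 * C_δ * C_S * (divWeight n ^ 2 / n) := by
    intro n hn
    have hn' := Finset.mem_Icc.1 hn
    have hn0 : n ≠ 0 := by omega
    have hn0' : (0 : ℝ) < n := by exact_mod_cast hn'.1
    have hy : 1 ≤ M / n := by
      rw [le_div_iff₀ hn0', one_mul]; exact le_trans (by exact_mod_cast hn'.2) hNM
    set u : ℝ := Real.log (M / n) with hu
    have hu0 : 0 ≤ u := Real.log_nonneg hy
    have h1 := hδ n hn0 _ hy
    have h2 := abs_primeSum_le hS hM hn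
    have hc := totient_mul_W_sq_le n
    have hc0 := totient_mul_W_sq_nonneg n
    have hD0 := divWeight_nonneg n
    have hw : (u + Real.log 4) / (1 + u) ^ 2 ≤ 2 := by
      rw [div_le_iff₀ (by positivity)]; nlinarith
    rw [abs_mul, abs_of_nonneg hc0, abs_mul]
    calc (Nat.totient n : ℝ) * W n ^ 2 * (|coprimeSum n (M / n) - 2 * mainConst n| * |primeSum M n|)
        ≤ (n : ℝ)⁻¹ * (C_δ * divWeight n / (1 + u) ^ 2 * (2 * C_S * divWeight n * (u + Real.log 4))) :=
          mul_le_mul hc (mul_le_mul h1 h2 (abs_nonneg _) (by positivity)) (by positivity) (by positivity)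
      _ = 2 * C_δ * C_S * (divWeight n ^ 2 / n) * ((u + Real.log 4) / (1 + u) ^ 2) := by
          field_simp
      _ ≤ 2 * C_δ * C_S * (divWeight n ^ 2 / n) * 2 :=
          mul_le_mul_of_nonneg_left hw (by positivity)
      _ = 4 * C_δ * C_S * (divWeight n ^ 2 / n) := by ring
  refine (Finset.abs_sum_le_sum_abs _ _).trans ((Finset.sum_le_sum hterm).trans ?_)
  rw [← Finset.mul_sum]
  refine mul_le_mul_of_nonneg_left ((sum_divWeight_sq_div_le hN1).trans ?_) (by positivity)
  have hlog : Real.log (⌊M⌋₊ : ℝ) ≤ Real.log M := Real.log_le_log (by exact_mod_cast hN1) hNM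
  have hZ : 0 ≤ (∑' d : ℕ, (d : ℝ) ^ (-(5 / 4 : ℝ))) ^ 2 := sq_nonneg _
  nlinarith

end Summit.Parity.GeneralizedHardyLittlewood.Theorems.BeyondDiagonalBeatsQuarter.KernelFormXSq
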